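import Summits.CriticalPhenomena.PercolationContinuityZ3.Theorems.Transplant.FKThreeApexPinnedNC
import Summits.CriticalPhenomena.PercolationContinuityZ3.Theorems.Transplant.FKThreeApexT2
import Summits.CriticalPhenomena.PercolationContinuityZ3.Theorems.Transplant.FKThreeApexPinned
import Summits.CriticalPhenomena.PercolationContinuityZ3.Theorems.Transplant.FKConnectivityAllQDegThree
import HarnessLib

/-!
# Connectivity correlation inequalities for `φ_{w,q}`, `0 < q ≤ 1` — ADJACENT EDGES OF THE WEIGHTED `K_{1,1,1,n}` ARE NEGATIVELY CORRELATED
# (every graph with a vertex cover of size `≤ 3`)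

Support file (`--supports stmt-CriticalPhenomena-4575`), FK sub-lane `prim-bschramm-fk-3` (gen 13); builds on p205010 (kernel theorem, internal audit
signed; external expert review pending).  No named facts, no sorries; standard axioms.  Layer 3c-ii of the `K_{1,1,1,n}` programme (memo
`bschramm/prim-bschramm-fk-3/THREE-APEX.md` §4, §6) — the measure-level theorem for all four ADJACENT pair types.

Setting (`…ThreeApexWordTri`): finite `V`, `card V = n + 3`, distinct apices `a, b, c`, pairwise distinct leaves `v 0, …, v (n−1)` (none an apex),
`w : Sym2 V → [0,1]` supported on the apex–leaf pairs and the triangle `ab, ac, bc` (the weighted `K_{1,1,1,n} = K₃ + E_n`; ARBITRARY parameters, so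
every graph with a vertex cover of size `≤ 3` is included as a weight-zero pattern: `K₄, K₅⁻, K₆ − E(K₃), K_{3,n}, K_{3,n}` plus edges, …), `0 < q ≤ 1`.
**`negCorr_adjacent_tri`**: any two distinct pairs `e ≠ f` of `K_{1,1,1,n}` with a common end-vertex satisfy
`φ_{w,q}(J_e ∩ J_f) ≤ φ_{w,q}(J_e)·φ_{w,q}(J_f)`; `NegCorrPairSupp` form `negCorrPairSupp_adjacent_tri`.  This is adjacent-edge negative correlation
(the slice `EdgeNegCorrAdjFKLtOne` of Grimmett's §3.9 problem; Wagner's Conj. 5.3 for the random-cluster model) for a new infinite family of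
3-connected non-series-parallel graphs, by the four pinned Rayleigh inequalities of the three-apex monoid:
T1 `rayleigh_T1_nonneg` (two edges at a leaf), T2 `rayleigh_T2_nonneg` (two edges at an apex to two leaves; Bernstein-certified, `…ThreeApexT2`),
T4 `rayleigh_T4_nonneg` (leaf edge / triangle edge), T6 `rayleigh_T6_nonneg` (two triangle edges = the MASTER inequality), transported to the measure
by the transfer formula `rcPartitionFunctionW_eq_transfer3T`, the pinning tools and `negCorr_of_pinned_rayleigh` (`…ThreeApexPinnedNC`).
The two DISJOINT pair types (T3: `u₁a, u₂b`; T5: `u a, bc`) remain open (memo §5).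
[cite: Grimmett2006, §1.4 eq. (1.20) (p. 15); §3.9 eq. (3.94), Conj. (3.96) (pp. 63–66)] [cite: Wagner2006, Conj. 5.3, Thm. 5.8, §5.3 (pp. 13–15)]
-/

noncomputable section

namespace Summit.CriticalPhenomena.PercolationContinuityZ3.Theorems

namespace FK

namespace ThreeApex

open Literature.Probability.LatticeModels Literature.Probability.Percolation
open scoped Classical

variable {V : Type*} [Fintype V]

/-! ### The four core cases in the setting `(a, b, c)` -/

section Setting

variable {a b c : V} {v : ℕ → V} {n : ℕ}
variable (hab : a ≠ b) (hac : a ≠ c) (hbc : b ≠ c) (hinj : ∀ j k, j < n → k < n → v j = v k → j = k)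
  (hva : ∀ j, j < n → v j ≠ a) (hvb : ∀ j, j < n → v j ≠ b) (hvc : ∀ j, j < n → v j ≠ c)
include hab hac hbc hinj hva hvb hvc

/-- **T1 in `K_{1,1,1,n}`**: the edges `s(a, v j₀)`, `s(b, v j₀)` at a leaf are negatively correlated. (transcription of bschramm/prim-bschramm-fk-3/THREE-APEX.md §4) -/
theorem negCorrTri_leaf_ab {q : ℝ} (hq0 : 0 < q) (hq1 : q ≤ 1) (hcard : Fintype.card V = n + 3) (w : Sym2 V → unitInterval)
    (hsupp : ∀ e, e ∉ fullPairs a b c v n → w e = 0) {j₀ : ℕ} (hj₀ : j₀ < n) :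
    (rcMeasureW w q ∅).real ({ω : BondConfig V | s(a, v j₀) ∈ ω} ∩ {ω | s(b, v j₀) ∈ ω}) ≤
      (rcMeasureW w q ∅).real {ω : BondConfig V | s(a, v j₀) ∈ ω} * (rcMeasureW w q ∅).real {ω : BondConfig V | s(b, v j₀) ∈ ω} := by
  obtain ⟨nab, -, -⟩ := pairs_at_leaf_ne hab hac hbc hva hvb hj₀
  have hea : s(a, v j₀) ∈ fullPairs a b c v n := mem_fullPairs_of (Or.inl ((mem_apexPairs_iff _).2 ⟨j₀, hj₀, Or.inl rfl⟩))
  have hfb : s(b, v j₀) ∈ fullPairs a b c v n := mem_fullPairs_of (Or.inl ((mem_apexPairs_iff _).2 ⟨j₀, hj₀, Or.inr (Or.inl rfl)⟩))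
  set R := triLetter w a b c * ∏ j ∈ (Finset.range n).erase j₀, leafOf q w a b c (v j) with hR
  have hRK : InK q R := (inK_triLetter q w a b c).mul (inK_prod _ _ fun j _ => isLetter_leafOf q w a b c (v j))
  have hZ : ∀ σ τ : unitInterval, rcPartitionFunctionW (Function.update (Function.update w s(a, v j₀) σ) s(b, v j₀) τ) q ∅ =
      val q (leaf q (σ : ℝ) (τ : ℝ) ((w s(c, v j₀) : unitInterval) : ℝ) * R) := by
    intro σ τ
    rw [rcPartitionFunctionW_eq_transfer3T hab hac hbc hinj hva hvb hvc hcard q _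
      (supp_update_fullPair _ (supp_update_fullPair w hsupp hea σ) hfb τ), transfer3T,
      triLetter_pin_leaves hva hvb hvc w a b hj₀ hj₀ σ τ, zvec_pin_leaf hab hac hbc hinj hva hvb hvc q w hj₀ σ τ, hR, mul_left_comm]
  refine negCorr_of_pinned_rayleigh w hq0 nab.symm ?_
  rw [hZ, hZ, hZ, hZ, Set.Icc.coe_one, Set.Icc.coe_zero]
  have h := rayleigh_T1_nonneg hq0.le hq1 (w s(c, v j₀)).2.1 (w s(c, v j₀)).2.2 hRK
  simp only [← mul_def] at h
  linarith

/-- **T2 in `K_{1,1,1,n}`**: the edges `s(a, v j₁)`, `s(a, v j₂)` from the apex `a` to two distinct leaves are negatively correlated.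
(transcription of bschramm/prim-bschramm-fk-3/THREE-APEX.md §4) -/
theorem negCorrTri_apex_a {q : ℝ} (hq0 : 0 < q) (hq1 : q ≤ 1) (hcard : Fintype.card V = n + 3) (w : Sym2 V → unitInterval)
    (hsupp : ∀ e, e ∉ fullPairs a b c v n → w e = 0) {j₁ j₂ : ℕ} (hj₁ : j₁ < n) (hj₂ : j₂ < n) (hne : j₁ ≠ j₂) :
    (rcMeasureW w q ∅).real ({ω : BondConfig V | s(a, v j₁) ∈ ω} ∩ {ω | s(a, v j₂) ∈ ω}) ≤
      (rcMeasureW w q ∅).real {ω : BondConfig V | s(a, v j₁) ∈ ω} * (rcMeasureW w q ∅).real {ω : BondConfig V | s(a, v j₂) ∈ ω} := by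
  have hfe : s(a, v j₂) ≠ s(a, v j₁) := pair_ne_of_ne hinj hva hvb hvc (x := a) (y := a) (Or.inl rfl) hj₂ hj₁ (Ne.symm hne)
  have he : s(a, v j₁) ∈ fullPairs a b c v n := mem_fullPairs_of (Or.inl ((mem_apexPairs_iff _).2 ⟨j₁, hj₁, Or.inl rfl⟩))
  have hf : s(a, v j₂) ∈ fullPairs a b c v n := mem_fullPairs_of (Or.inl ((mem_apexPairs_iff _).2 ⟨j₂, hj₂, Or.inl rfl⟩))
  set R := triLetter w a b c * ∏ j ∈ ((Finset.range n).erase j₁).erase j₂, leafOf q w a b c (v j) with hR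
  have hRK : InK q R := (inK_triLetter q w a b c).mul (inK_prod _ _ fun j _ => isLetter_leafOf q w a b c (v j))
  have hZ : ∀ σ τ : unitInterval, rcPartitionFunctionW (Function.update (Function.update w s(a, v j₁) σ) s(a, v j₂) τ) q ∅ =
      val q (leaf q (σ : ℝ) ((w s(b, v j₁) : unitInterval) : ℝ) ((w s(c, v j₁) : unitInterval) : ℝ) *
        (leaf q (τ : ℝ) ((w s(b, v j₂) : unitInterval) : ℝ) ((w s(c, v j₂) : unitInterval) : ℝ) * R)) := by
    intro σ τ
    rw [rcPartitionFunctionW_eq_transfer3T hab hac hbc hinj hva hvb hvc hcard q _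
      (supp_update_fullPair _ (supp_update_fullPair w hsupp he σ) hf τ), transfer3T,
      triLetter_pin_leaves hva hvb hvc w a a hj₁ hj₂ σ τ, zvec_pin_two hab hac hbc hinj hva hvb hvc q w hj₁ hj₂ hne σ τ, hR]
    congr 1
    ac_rfl
  refine negCorr_of_pinned_rayleigh w hq0 hfe ?_
  rw [hZ, hZ, hZ, hZ, Set.Icc.coe_one, Set.Icc.coe_zero]
  have h := rayleigh_T2_nonneg hq0.le hq1 (w s(b, v j₁)).2.1 (w s(b, v j₁)).2.2 (w s(c, v j₁)).2.1 (w s(c, v j₁)).2.2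
    (w s(b, v j₂)).2.1 (w s(b, v j₂)).2.2 (w s(c, v j₂)).2.1 (w s(c, v j₂)).2.2 hRK
  simp only [← mul_def] at h
  linarith

/-- **T4 in `K_{1,1,1,n}`**: the leaf edge `s(a, v j₀)` and the triangle edge `s(a, b)` are negatively correlated.
(transcription of bschramm/prim-bschramm-fk-3/THREE-APEX.md §4) -/
theorem negCorrTri_leaf_tri {q : ℝ} (hq0 : 0 < q) (hq1 : q ≤ 1) (hcard : Fintype.card V = n + 3) (w : Sym2 V → unitInterval)
    (hsupp : ∀ e, e ∉ fullPairs a b c v n → w e = 0) {j₀ : ℕ} (hj₀ : j₀ < n) :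
    (rcMeasureW w q ∅).real ({ω : BondConfig V | s(a, v j₀) ∈ ω} ∩ {ω | s(a, b) ∈ ω}) ≤
      (rcMeasureW w q ∅).real {ω : BondConfig V | s(a, v j₀) ∈ ω} * (rcMeasureW w q ∅).real {ω : BondConfig V | s(a, b) ∈ ω} := by
  obtain ⟨m1, -, -⟩ := apexPair_ne_tri hva hvb hvc (v := v) a hj₀
  have he : s(a, v j₀) ∈ fullPairs a b c v n := mem_fullPairs_of (Or.inl ((mem_apexPairs_iff _).2 ⟨j₀, hj₀, Or.inl rfl⟩))
  have hab' : s(a, b) ∈ triPairs a b c := (mem_triPairs_iff a b c _).2 (Or.inl rfl)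
  have hf : s(a, b) ∈ fullPairs a b c v n := mem_fullPairs_of (Or.inr hab')
  set R := (edgeAC ((w s(a, c) : unitInterval) : ℝ) * edgeBC ((w s(b, c) : unitInterval) : ℝ)) *
    ∏ j ∈ (Finset.range n).erase j₀, leafOf q w a b c (v j) with hR
  have hRK : InK q R :=
    ((IsLetter.ac (q := q) (w s(a, c)).2.1 (w s(a, c)).2.2).inK.mul (IsLetter.bc (q := q) (w s(b, c)).2.1 (w s(b, c)).2.2).inK).mul
      (inK_prod _ _ fun j _ => isLetter_leafOf q w a b c (v j))
  have hZ : ∀ σ τ : unitInterval, rcPartitionFunctionW (Function.update (Function.update w s(a, v j₀) σ) s(a, b) τ) q ∅ =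
      val q (leaf q (σ : ℝ) ((w s(b, v j₀) : unitInterval) : ℝ) ((w s(c, v j₀) : unitInterval) : ℝ) * (edgeAB (τ : ℝ) * R)) := by
    intro σ τ
    rw [rcPartitionFunctionW_eq_transfer3T hab hac hbc hinj hva hvb hvc hcard q _
      (supp_update_fullPair _ (supp_update_fullPair w hsupp he σ) hf τ), transfer3T,
      triLetter_pin_leaf_ab hab hac hbc hva hvb hvc (v := v) w hj₀ σ τ, zvec_pin_leaf_tri hab hac hbc hinj hva hvb hvc q w hab' hj₀ σ τ, hR]
    congr 1
    ac_rfl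
  refine negCorr_of_pinned_rayleigh w hq0 m1.symm ?_
  rw [hZ, hZ, hZ, hZ, Set.Icc.coe_one, Set.Icc.coe_zero]
  have h := rayleigh_T4_nonneg hq0.le hq1 (w s(b, v j₀)).2.1 (w s(b, v j₀)).2.2 (w s(c, v j₀)).2.1 (w s(c, v j₀)).2.2 hRK
  simp only [← mul_def] at h
  linarith

/-- **T6 in `K_{1,1,1,n}`**: the triangle edges `s(a, b)`, `s(b, c)` are negatively correlated (the MASTER inequality).
(transcription of bschramm/prim-bschramm-fk-3/THREE-APEX.md §2) -/
theorem negCorrTri_tri_tri {q : ℝ} (hq0 : 0 < q) (hq1 : q ≤ 1) (hcard : Fintype.card V = n + 3) (w : Sym2 V → unitInterval)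
    (hsupp : ∀ e, e ∉ fullPairs a b c v n → w e = 0) :
    (rcMeasureW w q ∅).real ({ω : BondConfig V | s(a, b) ∈ ω} ∩ {ω | s(b, c) ∈ ω}) ≤
      (rcMeasureW w q ∅).real {ω : BondConfig V | s(a, b) ∈ ω} * (rcMeasureW w q ∅).real {ω : BondConfig V | s(b, c) ∈ ω} := by
  obtain ⟨-, n13, -⟩ := triPairs_ne hab hac hbc (V := V)
  have he' : s(a, b) ∈ triPairs a b c := (mem_triPairs_iff a b c _).2 (Or.inl rfl)
  have hf' : s(b, c) ∈ triPairs a b c := (mem_triPairs_iff a b c _).2 (Or.inr (Or.inr rfl))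
  have he : s(a, b) ∈ fullPairs a b c v n := mem_fullPairs_of (Or.inr he')
  have hf : s(b, c) ∈ fullPairs a b c v n := mem_fullPairs_of (Or.inr hf')
  set R := edgeAC ((w s(a, c) : unitInterval) : ℝ) * zvec q w a b c v n with hR
  have hRK : InK q R := (IsLetter.ac (q := q) (w s(a, c)).2.1 (w s(a, c)).2.2).inK.mul (inK_zvec q w a b c v n)
  have hZ : ∀ σ τ : unitInterval, rcPartitionFunctionW (Function.update (Function.update w s(a, b) σ) s(b, c) τ) q ∅ =
      val q (edgeAB (σ : ℝ) * (edgeBC (τ : ℝ) * R)) := by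
    intro σ τ
    rw [rcPartitionFunctionW_eq_transfer3T hab hac hbc hinj hva hvb hvc hcard q _
      (supp_update_fullPair _ (supp_update_fullPair w hsupp he σ) hf τ), transfer3T,
      triLetter_pin_ab_bc hab hac hbc w σ τ, zvec_pin_tri_tri hva hvb hvc q w he' hf' σ τ, hR]
    congr 1
    ac_rfl
  refine negCorr_of_pinned_rayleigh w hq0 n13.symm ?_
  rw [hZ, hZ, hZ, hZ, Set.Icc.coe_one, Set.Icc.coe_zero]
  have h := rayleigh_T6_nonneg hq0.le hq1 hRK
  simp only [← mul_def] at h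
  linarith

end Setting

/-! ### All adjacent pairs, by relabelling the apices -/

section AllPairs

variable {a b c : V} {v : ℕ → V} {n : ℕ}
variable (hab : a ≠ b) (hac : a ≠ c) (hbc : b ≠ c) (hinj : ∀ j k, j < n → k < n → v j = v k → j = k)
  (hva : ∀ j, j < n → v j ≠ a) (hvb : ∀ j, j < n → v j ≠ b) (hvc : ∀ j, j < n → v j ≠ c)
include hab hac hbc hinj hva hvb hvc

omit [Fintype V] hab hac hbc hinj hva hvb hvc in
/-- Negative correlation of a pair of events is symmetric. [folklore] -/
theorem negCorr_symm {μ : MeasureTheory.Measure (BondConfig V)} {e f : Sym2 V}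
    (h : μ.real ({ω : BondConfig V | e ∈ ω} ∩ {ω | f ∈ ω}) ≤ μ.real {ω : BondConfig V | e ∈ ω} * μ.real {ω : BondConfig V | f ∈ ω}) :
    μ.real ({ω : BondConfig V | f ∈ ω} ∩ {ω | e ∈ ω}) ≤ μ.real {ω : BondConfig V | f ∈ ω} * μ.real {ω : BondConfig V | e ∈ ω} := by
  rw [Set.inter_comm, mul_comm]; exact h

/-- Two edges at a common leaf (`x ≠ y` apices). (transcription of bschramm/prim-bschramm-fk-3/THREE-APEX.md §4) -/
theorem negCorrTri_leaf {q : ℝ} (hq0 : 0 < q) (hq1 : q ≤ 1) (hcard : Fintype.card V = n + 3) (w : Sym2 V → unitInterval)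
    (hsupp : ∀ e, e ∉ fullPairs a b c v n → w e = 0) {j₀ : ℕ} (hj₀ : j₀ < n) {x y : V} (hx : x = a ∨ x = b ∨ x = c)
    (hy : y = a ∨ y = b ∨ y = c) (hxy : x ≠ y) :
    (rcMeasureW w q ∅).real ({ω : BondConfig V | s(x, v j₀) ∈ ω} ∩ {ω | s(y, v j₀) ∈ ω}) ≤
      (rcMeasureW w q ∅).real {ω : BondConfig V | s(x, v j₀) ∈ ω} * (rcMeasureW w q ∅).real {ω : BondConfig V | s(y, v j₀) ∈ ω} := by
  have hab' := negCorrTri_leaf_ab hab hac hbc hinj hva hvb hvc hq0 hq1 hcard w hsupp hj₀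
  have hac' : (rcMeasureW w q ∅).real ({ω : BondConfig V | s(a, v j₀) ∈ ω} ∩ {ω | s(c, v j₀) ∈ ω}) ≤
      (rcMeasureW w q ∅).real {ω : BondConfig V | s(a, v j₀) ∈ ω} * (rcMeasureW w q ∅).real {ω : BondConfig V | s(c, v j₀) ∈ ω} :=
    negCorrTri_leaf_ab hac hab hbc.symm hinj hva hvc hvb hq0 hq1 hcard w (by rw [fullPairs_swap₂₃]; exact hsupp) hj₀
  have hbc' : (rcMeasureW w q ∅).real ({ω : BondConfig V | s(b, v j₀) ∈ ω} ∩ {ω | s(c, v j₀) ∈ ω}) ≤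
      (rcMeasureW w q ∅).real {ω : BondConfig V | s(b, v j₀) ∈ ω} * (rcMeasureW w q ∅).real {ω : BondConfig V | s(c, v j₀) ∈ ω} :=
    negCorrTri_leaf_ab hbc hab.symm hac.symm hinj hvb hvc hva hq0 hq1 hcard w (by rw [fullPairs_rotate]; exact hsupp) hj₀
  rcases hx with rfl | rfl | rfl <;> rcases hy with rfl | rfl | rfl
  · exact absurd rfl hxy
  · exact hab'
  · exact hac'
  · exact negCorr_symm hab'
  · exact absurd rfl hxy
  · exact hbc'
  · exact negCorr_symm hac'
  · exact negCorr_symm hbc'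
  · exact absurd rfl hxy

/-- Two edges from a common apex `x` to distinct leaves. (transcription of bschramm/prim-bschramm-fk-3/THREE-APEX.md §4) -/
theorem negCorrTri_apex {q : ℝ} (hq0 : 0 < q) (hq1 : q ≤ 1) (hcard : Fintype.card V = n + 3) (w : Sym2 V → unitInterval)
    (hsupp : ∀ e, e ∉ fullPairs a b c v n → w e = 0) {j₁ j₂ : ℕ} (hj₁ : j₁ < n) (hj₂ : j₂ < n) (hne : j₁ ≠ j₂) {x : V}
    (hx : x = a ∨ x = b ∨ x = c) :
    (rcMeasureW w q ∅).real ({ω : BondConfig V | s(x, v j₁) ∈ ω} ∩ {ω | s(x, v j₂) ∈ ω}) ≤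
      (rcMeasureW w q ∅).real {ω : BondConfig V | s(x, v j₁) ∈ ω} * (rcMeasureW w q ∅).real {ω : BondConfig V | s(x, v j₂) ∈ ω} := by
  rcases hx with rfl | rfl | rfl
  · exact negCorrTri_apex_a hab hac hbc hinj hva hvb hvc hq0 hq1 hcard w hsupp hj₁ hj₂ hne
  · exact negCorrTri_apex_a hbc hab.symm hac.symm hinj hvb hvc hva hq0 hq1 hcard w (by rw [fullPairs_rotate]; exact hsupp) hj₁ hj₂ hne
  · exact negCorrTri_apex_a hac.symm hbc.symm hab hinj hvc hva hvb hq0 hq1 hcard w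
      (by rw [fullPairs_rotate, fullPairs_rotate]; exact hsupp) hj₁ hj₂ hne

/-- A leaf edge `s(x, v j₀)` against a triangle edge `f` containing `x`. (transcription of bschramm/prim-bschramm-fk-3/THREE-APEX.md §4) -/
theorem negCorrTri_leaf_edge {q : ℝ} (hq0 : 0 < q) (hq1 : q ≤ 1) (hcard : Fintype.card V = n + 3) (w : Sym2 V → unitInterval)
    (hsupp : ∀ e, e ∉ fullPairs a b c v n → w e = 0) {j₀ : ℕ} (hj₀ : j₀ < n) {x : V} (hx : x = a ∨ x = b ∨ x = c) {f : Sym2 V}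
    (hf : f ∈ triPairs a b c) (hxf : x ∈ f) :
    (rcMeasureW w q ∅).real ({ω : BondConfig V | s(x, v j₀) ∈ ω} ∩ {ω | f ∈ ω}) ≤
      (rcMeasureW w q ∅).real {ω : BondConfig V | s(x, v j₀) ∈ ω} * (rcMeasureW w q ∅).real {ω : BondConfig V | f ∈ ω} := by
  -- the six (apex, triangle edge ∋ apex) cases, each a relabelled instance of `negCorrTri_leaf_tri`
  have hAab : (rcMeasureW w q ∅).real ({ω : BondConfig V | s(a, v j₀) ∈ ω} ∩ {ω | s(a, b) ∈ ω}) ≤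
      (rcMeasureW w q ∅).real {ω : BondConfig V | s(a, v j₀) ∈ ω} * (rcMeasureW w q ∅).real {ω : BondConfig V | s(a, b) ∈ ω} :=
    negCorrTri_leaf_tri hab hac hbc hinj hva hvb hvc hq0 hq1 hcard w hsupp hj₀
  have hBab : (rcMeasureW w q ∅).real ({ω : BondConfig V | s(b, v j₀) ∈ ω} ∩ {ω | s(a, b) ∈ ω}) ≤
      (rcMeasureW w q ∅).real {ω : BondConfig V | s(b, v j₀) ∈ ω} * (rcMeasureW w q ∅).real {ω : BondConfig V | s(a, b) ∈ ω} := by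
    have h := negCorrTri_leaf_tri hab.symm hbc hac hinj hvb hva hvc hq0 hq1 hcard w (by rw [fullPairs_swap₁₂]; exact hsupp) hj₀
    rwa [Sym2.eq_swap (a := b) (b := a)] at h
  have hAac : (rcMeasureW w q ∅).real ({ω : BondConfig V | s(a, v j₀) ∈ ω} ∩ {ω | s(a, c) ∈ ω}) ≤
      (rcMeasureW w q ∅).real {ω : BondConfig V | s(a, v j₀) ∈ ω} * (rcMeasureW w q ∅).real {ω : BondConfig V | s(a, c) ∈ ω} :=
    negCorrTri_leaf_tri hac hab hbc.symm hinj hva hvc hvb hq0 hq1 hcard w (by rw [fullPairs_swap₂₃]; exact hsupp) hj₀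
  have hCac : (rcMeasureW w q ∅).real ({ω : BondConfig V | s(c, v j₀) ∈ ω} ∩ {ω | s(a, c) ∈ ω}) ≤
      (rcMeasureW w q ∅).real {ω : BondConfig V | s(c, v j₀) ∈ ω} * (rcMeasureW w q ∅).real {ω : BondConfig V | s(a, c) ∈ ω} := by
    have h := negCorrTri_leaf_tri hac.symm hbc.symm hab hinj hvc hva hvb hq0 hq1 hcard w
      (by rw [fullPairs_rotate, fullPairs_rotate]; exact hsupp) hj₀
    rwa [Sym2.eq_swap (a := c) (b := a)] at h
  have hBbc : (rcMeasureW w q ∅).real ({ω : BondConfig V | s(b, v j₀) ∈ ω} ∩ {ω | s(b, c) ∈ ω}) ≤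
      (rcMeasureW w q ∅).real {ω : BondConfig V | s(b, v j₀) ∈ ω} * (rcMeasureW w q ∅).real {ω : BondConfig V | s(b, c) ∈ ω} :=
    negCorrTri_leaf_tri hbc hab.symm hac.symm hinj hvb hvc hva hq0 hq1 hcard w (by rw [fullPairs_rotate]; exact hsupp) hj₀
  have hCbc : (rcMeasureW w q ∅).real ({ω : BondConfig V | s(c, v j₀) ∈ ω} ∩ {ω | s(b, c) ∈ ω}) ≤
      (rcMeasureW w q ∅).real {ω : BondConfig V | s(c, v j₀) ∈ ω} * (rcMeasureW w q ∅).real {ω : BondConfig V | s(b, c) ∈ ω} := by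
    have h := negCorrTri_leaf_tri hbc.symm hac.symm hab.symm hinj hvc hvb hva hq0 hq1 hcard w
      (by rw [fullPairs_swap₂₃, fullPairs_rotate, fullPairs_rotate]; exact hsupp) hj₀
    rwa [Sym2.eq_swap (a := c) (b := b)] at h
  have nab : a ∉ s(b, c) := by rw [Sym2.mem_iff, not_or]; exact ⟨hab, hac⟩
  have nba : b ∉ s(a, c) := by rw [Sym2.mem_iff, not_or]; exact ⟨Ne.symm hab, hbc⟩
  have nca : c ∉ s(a, b) := by rw [Sym2.mem_iff, not_or]; exact ⟨Ne.symm hac, Ne.symm hbc⟩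
  rcases (mem_triPairs_iff a b c f).1 hf with rfl | rfl | rfl <;> rcases hx with rfl | rfl | rfl
  · exact hAab
  · exact hBab
  · exact absurd hxf nca
  · exact hAac
  · exact absurd hxf nba
  · exact hCac
  · exact absurd hxf nab
  · exact hBbc
  · exact hCbc

/-- Two distinct triangle edges. (transcription of bschramm/prim-bschramm-fk-3/THREE-APEX.md §2) -/
theorem negCorrTri_edges {q : ℝ} (hq0 : 0 < q) (hq1 : q ≤ 1) (hcard : Fintype.card V = n + 3) (w : Sym2 V → unitInterval)
    (hsupp : ∀ e, e ∉ fullPairs a b c v n → w e = 0) {e f : Sym2 V} (he : e ∈ triPairs a b c) (hf : f ∈ triPairs a b c) (hfe : f ≠ e) :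
    (rcMeasureW w q ∅).real ({ω : BondConfig V | e ∈ ω} ∩ {ω | f ∈ ω}) ≤
      (rcMeasureW w q ∅).real {ω : BondConfig V | e ∈ ω} * (rcMeasureW w q ∅).real {ω : BondConfig V | f ∈ ω} := by
  -- the three unordered pairs
  have h1 := negCorrTri_tri_tri hab hac hbc hinj hva hvb hvc hq0 hq1 hcard w hsupp
  have h2 : (rcMeasureW w q ∅).real ({ω : BondConfig V | s(a, b) ∈ ω} ∩ {ω | s(a, c) ∈ ω}) ≤
      (rcMeasureW w q ∅).real {ω : BondConfig V | s(a, b) ∈ ω} * (rcMeasureW w q ∅).real {ω : BondConfig V | s(a, c) ∈ ω} := by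
    have h := negCorrTri_tri_tri hab.symm hbc hac hinj hvb hva hvc hq0 hq1 hcard w (by rw [fullPairs_swap₁₂]; exact hsupp)
    rwa [Sym2.eq_swap (a := b) (b := a)] at h
  have h3 : (rcMeasureW w q ∅).real ({ω : BondConfig V | s(a, c) ∈ ω} ∩ {ω | s(b, c) ∈ ω}) ≤
      (rcMeasureW w q ∅).real {ω : BondConfig V | s(a, c) ∈ ω} * (rcMeasureW w q ∅).real {ω : BondConfig V | s(b, c) ∈ ω} := by
    have h := negCorrTri_tri_tri hac hab hbc.symm hinj hva hvc hvb hq0 hq1 hcard w (by rw [fullPairs_swap₂₃]; exact hsupp)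
    rwa [Sym2.eq_swap (a := c) (b := b)] at h
  rcases (mem_triPairs_iff a b c e).1 he with rfl | rfl | rfl <;> rcases (mem_triPairs_iff a b c f).1 hf with rfl | rfl | rfl
  · exact absurd rfl hfe
  · exact h2
  · exact h1
  · exact negCorr_symm h2
  · exact absurd rfl hfe
  · exact h3
  · exact negCorr_symm h1
  · exact negCorr_symm h3
  · exact absurd rfl hfe

/-- **ADJACENT EDGES OF THE WEIGHTED `K_{1,1,1,n}` ARE NEGATIVELY CORRELATED** — any two distinct pairs of `K_{1,1,1,n}` (apex–leaf pairs and the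
triangle) with a common end-vertex, under every `φ_{w,q}` supported on `K_{1,1,1,n}`, `0 < q ≤ 1`, for every `n` and all weights; in particular
adjacent-edge negative correlation holds on every graph with a vertex cover of size `≤ 3`. (transcription of bschramm/prim-bschramm-fk-3/THREE-APEX.md §4) -/
theorem negCorr_adjacent_tri {q : ℝ} (hq0 : 0 < q) (hq1 : q ≤ 1) (hcard : Fintype.card V = n + 3) (w : Sym2 V → unitInterval)
    (hsupp : ∀ e, e ∉ fullPairs a b c v n → w e = 0) {e f : Sym2 V} (he : e ∈ fullPairs a b c v n) (hf : f ∈ fullPairs a b c v n)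
    (hfe : f ≠ e) (hadj : ∃ z : V, z ∈ e ∧ z ∈ f) :
    (rcMeasureW w q ∅).real ({ω : BondConfig V | e ∈ ω} ∩ {ω | f ∈ ω}) ≤
      (rcMeasureW w q ∅).real {ω : BondConfig V | e ∈ ω} * (rcMeasureW w q ∅).real {ω : BondConfig V | f ∈ ω} := by
  -- a leaf edge `s(x, v j)` against a triangle edge `g` sharing a vertex: the shared vertex is `x`
  have leaf_edge : ∀ {x : V} (_ : x = a ∨ x = b ∨ x = c) {j : ℕ} (_ : j < n) {g : Sym2 V} (_ : g ∈ triPairs a b c)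
      (_ : ∃ z : V, z ∈ s(x, v j) ∧ z ∈ g),
      (rcMeasureW w q ∅).real ({ω : BondConfig V | s(x, v j) ∈ ω} ∩ {ω | g ∈ ω}) ≤
        (rcMeasureW w q ∅).real {ω : BondConfig V | s(x, v j) ∈ ω} * (rcMeasureW w q ∅).real {ω : BondConfig V | g ∈ ω} := by
    intro x hx j hj g hg hz
    obtain ⟨z, hze, hzg⟩ := hz
    have hxg : x ∈ g := by
      rcases Sym2.mem_iff.1 hze with rfl | rfl
      · exact hzg
      · exfalso
        rcases (mem_triPairs_iff a b c g).1 hg with rfl | rfl | rfl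
        · rcases Sym2.mem_iff.1 hzg with h | h
          · exact hva j hj h
          · exact hvb j hj h
        · rcases Sym2.mem_iff.1 hzg with h | h
          · exact hva j hj h
          · exact hvc j hj h
        · rcases Sym2.mem_iff.1 hzg with h | h
          · exact hvb j hj h
          · exact hvc j hj h
    exact negCorrTri_leaf_edge hab hac hbc hinj hva hvb hvc hq0 hq1 hcard w hsupp hj hx hg hxg
  rcases (mem_fullPairs_iff a b c v n e).1 he with he | he <;> rcases (mem_fullPairs_iff a b c v n f).1 hf with hf | hf
  · -- two apex–leaf pairs
    obtain ⟨j₁, hj₁, hx⟩ := (mem_apexPairs_iff e).1 he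
    obtain ⟨j₂, hj₂, hy⟩ := (mem_apexPairs_iff f).1 hf
    obtain ⟨x, hxabc, rfl⟩ : ∃ x, (x = a ∨ x = b ∨ x = c) ∧ e = s(x, v j₁) := by
      rcases hx with h | h | h
      · exact ⟨a, Or.inl rfl, h⟩
      · exact ⟨b, Or.inr (Or.inl rfl), h⟩
      · exact ⟨c, Or.inr (Or.inr rfl), h⟩
    obtain ⟨y, hyabc, rfl⟩ : ∃ y, (y = a ∨ y = b ∨ y = c) ∧ f = s(y, v j₂) := by
      rcases hy with h | h | h
      · exact ⟨a, Or.inl rfl, h⟩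
      · exact ⟨b, Or.inr (Or.inl rfl), h⟩
      · exact ⟨c, Or.inr (Or.inr rfl), h⟩
    have hxv : ∀ j, j < n → v j ≠ x := by
      rcases hxabc with rfl | rfl | rfl
      · exact hva
      · exact hvb
      · exact hvc
    have hyv : ∀ j, j < n → v j ≠ y := by
      rcases hyabc with rfl | rfl | rfl
      · exact hva
      · exact hvb
      · exact hvc
    by_cases hj : j₁ = j₂
    · subst hj
      have hxy : x ≠ y := fun h => hfe (by rw [h])
      exact negCorrTri_leaf hab hac hbc hinj hva hvb hvc hq0 hq1 hcard w hsupp hj₁ hxabc hyabc hxy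
    · obtain ⟨z, hze, hzf⟩ := hadj
      have hxy : x = y := by
        rcases Sym2.mem_iff.1 hze with rfl | rfl
        · rcases Sym2.mem_iff.1 hzf with h | h
          · exact h
          · exact absurd h.symm (hxv j₂ hj₂)
        · rcases Sym2.mem_iff.1 hzf with h | h
          · exact absurd h (hyv j₁ hj₁)
          · exact absurd (hinj j₁ j₂ hj₁ hj₂ h) hj
      subst hxy
      exact negCorrTri_apex hab hac hbc hinj hva hvb hvc hq0 hq1 hcard w hsupp hj₁ hj₂ hj hxabc
  · -- apex–leaf pair against triangle pair
    obtain ⟨j₁, hj₁, hx⟩ := (mem_apexPairs_iff e).1 he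
    obtain ⟨x, hxabc, rfl⟩ : ∃ x, (x = a ∨ x = b ∨ x = c) ∧ e = s(x, v j₁) := by
      rcases hx with h | h | h
      · exact ⟨a, Or.inl rfl, h⟩
      · exact ⟨b, Or.inr (Or.inl rfl), h⟩
      · exact ⟨c, Or.inr (Or.inr rfl), h⟩
    exact leaf_edge hxabc hj₁ hf hadj
  · -- triangle pair against apex–leaf pair
    obtain ⟨j₂, hj₂, hy⟩ := (mem_apexPairs_iff f).1 hf
    obtain ⟨y, hyabc, rfl⟩ : ∃ y, (y = a ∨ y = b ∨ y = c) ∧ f = s(y, v j₂) := by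
      rcases hy with h | h | h
      · exact ⟨a, Or.inl rfl, h⟩
      · exact ⟨b, Or.inr (Or.inl rfl), h⟩
      · exact ⟨c, Or.inr (Or.inr rfl), h⟩
    obtain ⟨z, hze, hzf⟩ := hadj
    exact negCorr_symm (leaf_edge hyabc hj₂ he ⟨z, hzf, hze⟩)
  · -- two triangle pairs
    exact negCorrTri_edges hab hac hbc hinj hva hvb hvc hq0 hq1 hcard w hsupp he hf hfe

/-- **`NegCorrPairSupp` form**: every ADJACENT pair of pairs of `K_{1,1,1,n}` is negatively correlated under every `φ_{w,q}` supported on the pairs of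
`K_{1,1,1,n}`, `0 < q ≤ 1` — adjacent-edge negative correlation on every graph with a vertex cover of size `≤ 3`.
(transcription of bschramm/prim-bschramm-fk-3/THREE-APEX.md §4) -/
theorem negCorrPairSupp_adjacent_tri {q : ℝ} (hq0 : 0 < q) (hq1 : q ≤ 1) (hcard : Fintype.card V = n + 3) {e f : Sym2 V}
    (he : e ∈ fullPairs a b c v n) (hf : f ∈ fullPairs a b c v n) (hfe : f ≠ e) (hadj : ∃ z : V, z ∈ e ∧ z ∈ f) :
    NegCorrPairSupp (↑(fullPairs a b c v n) : Set (Sym2 V)) q e f := by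
  intro w hw
  have hsupp : ∀ g, g ∉ fullPairs a b c v n → w g = 0 := by
    intro g hg
    by_contra h
    have h' : ((w g : unitInterval) : ℝ) ≠ 0 := fun h0 => h (Subtype.ext h0)
    exact hg (Finset.mem_coe.1 (hw g h'))
  exact negCorr_adjacent_tri hab hac hbc hinj hva hvb hvc hq0 hq1 hcard w hsupp he hf hfe hadj

end AllPairs

end ThreeApex

end FK

end Summit.CriticalPhenomena.PercolationContinuityZ3.Theorems

end
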